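import Summits.CriticalPhenomena.SAWScalingLimit.Theses.SAWEdgeOfPositiveType
import Literature.Analysis.Matrix.SchoenbergKernelsProofs

/-!
# `SchoenbergToMetric` (item stmt-CriticalPhenomena-13974, route SAWEdgeOfPositiveType)

`ConvexInfiniteDivisibility → ConvexMetricTriangle`: if every Hadamard power `(Z^Λ_x(u,v)^t)`,
`t > 0`, of the confined-SAW polymer kernel on a (convex) lattice domain `Λ` is positive definite,
then `√(−log Z^Λ_x)` satisfies the triangle inequality at every triple `a, b, c ∈ Λ` with
`Z(a,b), Z(b,c) > 0`.

Proof (Berg–Christensen–Ressel 1984, Ch. 3 Thm. 2.2 and Prop. 3.2, both PROVED in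
`Literature/Analysis/Matrix/SchoenbergKernelsProofs.lean`): if `Z(a,c) = 0` the left-hand side is
`√(−log 0) = 0` and there is nothing to prove; otherwise all nine values of `Z` on `{a,b,c}²` are
positive (unit diagonal: the only confined walk `u → u` is the trivial one; symmetry: the Hermitian
part of `Matrix.PosDef` at `t = 1`), the pulled-back kernels `(j,k) ↦ Z(e j, e k)^t` on `Fin 3`
(`e = (a,b,c)`) are positive definite kernels in the sense of
`Literature.Analysis.Matrix.IsPosDefKernel` (principal/pulled-back submatrices of a positive
definite matrix are positive semidefinite, `Matrix.PosSemidef.submatrix`), and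
`Literature.Analysis.Matrix.sqrt_neg_log_triangle_of_rpow_posDef` gives the claim. Convexity of
the domain and `x ≤ x_c` play no role in this implication.
-/

open Literature.Probability.LatticeModels Literature.Probability.RandomPlanarGeometry
open Literature.Probability.RandomPlanarGeometry.SAW.Zd (sawFun mem_sawFun)
open Literature.Analysis.Matrix

namespace Summit.CriticalPhenomena.SAWScalingLimit.Theorems

/-- **Schoenberg ⇒ metric, abstract form.** Let `Z : ι → ι → ℝ` be entrywise nonnegative with
`Z u u = 1` on a finset `Λ`, and suppose every Hadamard power `(Z(p,q)^t)_{p,q ∈ Λ}`, `t > 0`, is a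
positive definite matrix. Then for `a, b, c ∈ Λ` with `Z a b > 0` and `Z b c > 0`,
`√(−log Z(a,c)) ≤ √(−log Z(a,b)) + √(−log Z(b,c))` (if `Z(a,c) = 0` the left side is `0` by
`Real.log 0 = 0`; otherwise BCR Ch. 3 Thm. 2.2 + Prop. 3.2 on the three-point kernel).
[cite: BergChristensenRessel1984, Ch. 3 Thm. 2.2 and Prop. 3.2] -/
theorem sqrt_neg_log_triangle_of_finset_rpow_posDef {ι : Type*} {Λ : Finset ι} (Z : ι → ι → ℝ)
    (hnn : ∀ u v, 0 ≤ Z u v) (hdiag : ∀ u ∈ Λ, Z u u = 1)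
    (hPD : ∀ t : ℝ, 0 < t → (Matrix.of fun p q : Λ => Z p.1 q.1 ^ t).PosDef)
    {a b c : ι} (ha : a ∈ Λ) (hb : b ∈ Λ) (hc : c ∈ Λ) (hab : 0 < Z a b) (hbc : 0 < Z b c) :
    Real.sqrt (-Real.log (Z a c)) ≤
      Real.sqrt (-Real.log (Z a b)) + Real.sqrt (-Real.log (Z b c)) := by
  -- symmetry on `Λ`: the Hermitian part of positive definiteness at `t = 1`
  have hsymm : ∀ u, u ∈ Λ → ∀ v, v ∈ Λ → Z u v = Z v u := by
    intro u hu v hv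
    have h := (hPD 1 one_pos).isHermitian.apply ⟨v, hv⟩ ⟨u, hu⟩
    simpa [Matrix.of_apply, Real.rpow_one] using h
  rcases le_or_gt (Z a c) 0 with hac | hac
  · -- `Z a c = 0`: the left-hand side is `√(−log 0) = 0`
    have h0 : Z a c = 0 := le_antisymm hac (hnn a c)
    rw [h0, Real.log_zero, neg_zero, Real.sqrt_zero]
    exact add_nonneg (Real.sqrt_nonneg _) (Real.sqrt_nonneg _)
  · -- all entries positive on `{a, b, c}`: pull back to a kernel on `Fin 3`
    have key : ∀ e : Fin 3 → ι, (∀ j, e j ∈ Λ) → (∀ j k, 0 < Z (e j) (e k)) →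
        Real.sqrt (-Real.log (Z (e 0) (e 2))) ≤
          Real.sqrt (-Real.log (Z (e 0) (e 1))) + Real.sqrt (-Real.log (Z (e 1) (e 2))) := by
      intro e he hpos
      have hdiag' : ∀ j, Z (e j) (e j) = 1 := fun j => hdiag _ (he j)
      have hpow : ∀ t : ℝ, 0 < t → IsPosDefKernel fun j k => Z (e j) (e k) ^ t := by
        intro t ht
        refine ⟨fun j k => ?_, fun n x c => ?_⟩
        · have h := (hPD t ht).isHermitian.apply ⟨e k, he k⟩ ⟨e j, he j⟩
          simpa [Matrix.of_apply] using h
        · have h := sum_mul_mul_nonneg_of_posSemidef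
            ((hPD t ht).posSemidef.submatrix fun j => (⟨e (x j), he (x j)⟩ : Λ)) c
          simpa [Matrix.submatrix_apply, Matrix.of_apply] using h
      exact (sqrt_neg_log_triangle_of_rpow_posDef Schoenberg1938_negDef_iff_exp_posDef_holds
        BCR1984_sqrt_negDef_semimetric_holds (fun j k => Z (e j) (e k)) hpos hdiag' hpow).2 0 1 2
    have hba : 0 < Z b a := by rw [← hsymm a ha b hb]; exact hab
    have hcb : 0 < Z c b := by rw [← hsymm b hb c hc]; exact hbc
    have hca : 0 < Z c a := by rw [← hsymm a ha c hc]; exact hac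
    have haa : 0 < Z a a := by rw [hdiag a ha]; exact one_pos
    have hbb : 0 < Z b b := by rw [hdiag b hb]; exact one_pos
    have hcc : 0 < Z c c := by rw [hdiag c hc]; exact one_pos
    have h := key ![a, b, c] (by intro j; fin_cases j <;> simp [ha, hb, hc])
      (by intro j k; fin_cases j <;> fin_cases k <;>
            simp [hab, hbc, hac, hba, hcb, hca, haa, hbb, hcc])
    simpa using h

/-- **Item stmt-CriticalPhenomena-13974 (`SchoenbergToMetric`)**:
`ConvexInfiniteDivisibility → ConvexMetricTriangle` — infinite divisibility of the confined-SAW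
polymer kernel `Z^Λ_x` on a convex lattice domain makes `√(−log Z^Λ_x)` satisfy the triangle
inequality at every triple `a, b, c ∈ Λ` with `Z(a,b), Z(b,c) > 0`. The kernel is entrywise
nonnegative (`x ≥ 0`) with unit diagonal (the only confined self-avoiding walk from `u` to `u` is
the `0`-step walk), so `sqrt_neg_log_triangle_of_finset_rpow_posDef` applies.
[cite: BergChristensenRessel1984, Ch. 3 Thm. 2.2 and Prop. 3.2] -/
theorem SchoenbergToMetric_proof :
    Summit.CriticalPhenomena.SAWScalingLimit.Theses.SAWEdgeOfPositiveType.SchoenbergToMetric := by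
  intro hID K hK Λ hΛ x hx0 hxc a b c ha hb hc Z hab hbc
  have hPD : ∀ t : ℝ, 0 < t → (Matrix.of fun p q : Λ => Z p.1 q.1 ^ t).PosDef :=
    fun t ht => hID K hK Λ hΛ x t hx0 hxc ht
  have hnn : ∀ u v, 0 ≤ Z u v := fun u v =>
    Finset.sum_nonneg fun n _ => Finset.sum_nonneg fun _ _ => pow_nonneg hx0 n
  have hdiag : ∀ u ∈ Λ, Z u u = 1 := by
    intro u hu
    show ∑ n ∈ Finset.range Λ.card,
      ∑ _ω ∈ (sawFun 2 n (u - u)).filter (fun ω => ∀ i ≤ n, u + ω i ∈ Λ), x ^ n = 1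
    rw [Finset.sum_eq_single 0]
    · -- `n = 0`: the only confined `0`-step walk is the constant one, of weight `x ^ 0 = 1`
      rw [Finset.sum_eq_single_of_mem (fun _ => (0 : Site 2))]
      · exact pow_zero x
      · rw [Finset.mem_filter, mem_sawFun]
        refine ⟨⟨rfl, fun i _ => (sub_self u).symm, fun i hi => (Nat.not_lt_zero i hi).elim,
          ?_⟩, ?_⟩
        · intro i hi j hj _
          simp only [Set.mem_setOf_eq] at hi hj
          omega
        · intro i _
          simpa using hu
      · intro ω hω hne
        exfalso
        apply hne
        rw [Finset.mem_filter, mem_sawFun] at hω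
        funext i
        rw [hω.1.2.1 i (Nat.zero_le i), sub_self]
    · intro n _ hn
      refine Finset.sum_eq_zero fun ω hω => ?_
      exfalso
      rw [Finset.mem_filter, mem_sawFun] at hω
      obtain ⟨⟨h0, hend, -, hinj⟩, -⟩ := hω
      have h0n : (0 : ℕ) = n :=
        hinj (Nat.zero_le n) (le_refl n) (by rw [h0, hend n le_rfl, sub_self])
      exact hn h0n.symm
    · intro h
      exact (h (Finset.mem_range.2 (Finset.card_pos.2 ⟨u, hu⟩))).elim
  exact sqrt_neg_log_triangle_of_finset_rpow_posDef Z hnn hdiag hPD ha hb hc hab hbc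

end Summit.CriticalPhenomena.SAWScalingLimit.Theorems
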